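import Literature.NumberTheory.Sieve.GoldstonPintzYildirimMellin
import Literature.NumberTheory.LFunctions.PretentiousZeta
import Mathlib.Analysis.Complex.LocallyUniformLimit
import HarnessLib

/-!
# Goldston–Pintz–Yıldırım, *Primes in tuples I*, §6 (6.7)–(6.16): `F`, `G_H` and its bound

Trunk: NumberTheory / Sieve, continuing `GoldstonPintzYildirimCounting.lean` (`ν_p(H)`, `ν_d(H)`)
and `GoldstonPintzYildirimMellin.lean` ((6.7), `T_R` as a line integral of
`F(s) = ∑ μ(d)ν_d(H) d^{−1−s}`). GPY, *Primes in tuples. I* (Ann. of Math. 170 (2009) =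
arXiv:math/0508185), §6, p. 12:

* (6.7) `F(s) = ∑_d μ(d)ν_d(H) d^{−(1+s)} = ∏_p (1 − ν_p(H) p^{−(1+s)})`;
* (6.8) `F(s) = G_H(s) ζ(1+s)^{−k}`, `k = |H|`;
* (6.9) `G_H(s) = ∏_p (1 − ν_p(H) p^{−(1+s)})(1 − p^{−(1+s)})^{−k}`, "analytic and uniformly bounded
  for `σ > −1/2 + δ`";
* (6.10) `G_H(0) = 𝔖(H)`;
* (6.13)–(6.16) `Δ`, `U`, `log Δ ≤ U`, `|G_H(s)| ≪ exp(5kU^δ log log U)` for `−1/4 < σ ≤ 1`.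

Everything here is PROVED:

* `nu_mul_of_coprime` — `ν_d(H)` is multiplicative; `hasProd_FFactor` — **(6.7)**, the Euler
  product of `F` (for `Re s > 1/2`, where `∑ |μ(d)|ν_d(H) d^{−1−σ} < ∞` by `ν_d(H) ≤ k^{k²}√d`;
  Mathlib's `EulerProduct.eulerProduct_hasProd`);
* `GH_eq_FDir_mul`, `FDir_eq_GH_div` — **(6.8)** for `Re s > 1/2` (with Mathlib's Euler product
  of `ζ`);
* `GH_zero` — **(6.10)**, `G_H(0) = 𝔖(H)` (`Literature.NumberTheory.Sieve.GPY.singularSeriesNat`, i.e. the tree's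
  Hardy–Littlewood singular series `Literature.NumberTheory.Sieve.singularSeries` of the cast tuple, through
  `Literature.NumberTheory.Sieve.hasProd_singularSeriesFactor_holds`);
* `hasProd_GFactor_of_re`, `GH_eq_prod_mul_exp`, `differentiableOn_GH` — **(6.9)**: for
  `Re s > −1/2` the product converges, `G_H(s) = ∏_{p ≤ B_H} (…) · exp(∑_{p > B_H} g_p(s))` with
  `B_H = max(max H, 4k²)`, `g_p(s) = log(1 − k p^{−1−s}) − k log(1 − p^{−1−s})`,
  `|g_p(s)| ≤ 2k² p^{−2−2σ}`, and `G_H` is holomorphic on `Re s > −1/2`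
  (`Complex.differentiableOn_tsum_of_summable_norm` on the half-planes `Re s > −1/2 + δ`).

* `discr`, `nuPrime_eq_card_of_not_dvd`, `gpyU`, `log_discr_le_gpyU` — **(6.13)–(6.15)**:
  `Δ = ∏_{i<j}(h_j − h_i)`, `ν_p(H) = k` for `p ∤ Δ`, `U = max(16, 4k², k² log 2h)` (GPY's
  `U = Ck² log 2h` with `C = 1` and a floor making `U ≥ 16`, `2k ≤ √U`), `log Δ ≤ U`;
* `norm_GH_le` — **(6.16)** with explicit constants: for `σ ≥ −1/4`, `δ = max(−σ, 0)`,
  `|G_H(s)| ≤ exp(k U^δ (4 log log U + 25))` (GPY: `≪ exp(5kU^δ log log U)`), from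
  `|factor_p| ≤ e^{4k p^{−1−σ}}` (all `p`; used for `p ≤ U` with Mertens' bound
  `∑_{p ≤ U} 1/p ≤ log log U + 4` of `MertensElementary.lean`, and for the `≤ U/log 2` primes
  `p ∣ Δ`), and `|factor_p| ≤ e^{2k² p^{−2−2σ}}` (`p > U`, `p ∤ Δ`).

The contour shift (6.17) is the next step of the source (not here).

## References

* D. A. Goldston, J. Pintz, C. Y. Yıldırım, *Primes in tuples. I*, Ann. of Math. (2) 170 (2009),
  819–862 = arXiv:math/0508185, §6, (6.7)–(6.16), pp. 12–13; §2 (2.2).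
  [cite: GoldstonPintzYildirim2009]
* G. H. Hardy, E. M. Wright, *An Introduction to the Theory of Numbers*, 6th ed., OUP 2008,
  Thm 427 (Mertens). [cite: HardyWright2008]
-/

noncomputable section

open Finset Complex Filter Topology
open scoped ArithmeticFunction.Moebius ArithmeticFunction.omega

namespace Literature.NumberTheory.Sieve.GPY


/-! ### Multiplicativity of `ν_d(H)` -/

/-- `ν_1(H) = 1` (empty product). [folklore] -/
theorem nu_one (H : Finset ℕ) : nu H 1 = 1 := by simp [nu]

/-- `ν_0(H) = 1` (junk: empty product). [folklore] -/
theorem nu_zero (H : Finset ℕ) : nu H 0 = 1 := by simp [nu]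

/-- `ν_p(H)` at a prime is `nuPrime H p`. [folklore] -/
theorem nu_prime (H : Finset ℕ) {p : ℕ} (hp : p.Prime) : nu H p = nuPrime H p := by
  rw [nu, hp.primeFactors, prod_singleton]

/-- Multiplicativity: `ν_{ab}(H) = ν_a(H) ν_b(H)` for coprime `a, b`.
[cite: GoldstonPintzYildirim2009, Section 6 eq. 6.4] -/
theorem nu_mul_of_coprime (H : Finset ℕ) {a b : ℕ} (hab : a.Coprime b) :
    nu H (a * b) = nu H a * nu H b := by
  rw [nu, hab.primeFactors_mul, prod_union hab.disjoint_primeFactors]; rfl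

/-! ### `F(s)` and its Euler product ((6.7)) -/

/-- GPY (6.7): `F(s) = ∑_d μ(d) ν_d(H) d^{−(1+s)}`, absolutely convergent for `Re s > 1/2` (indeed
for `Re s > 0`); as a `tsum` it is `0` where not summable.
[cite: GoldstonPintzYildirim2009, Section 6 eq. 6.7] -/
def FDir (H : Finset ℕ) (s : ℂ) : ℂ := ∑' d : ℕ, (μ d : ℂ) * (nu H d : ℂ) / (d : ℂ) ^ (1 + s)

/-- The `d`-th term `μ(d) ν_d(H) d^{−(1+s)}` of `F(s)`.
[cite: GoldstonPintzYildirim2009, Section 6 eq. 6.7] -/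
def fTerm (H : Finset ℕ) (s : ℂ) (d : ℕ) : ℂ := (μ d : ℂ) * (nu H d : ℂ) / (d : ℂ) ^ (1 + s)

/-- `f(1) = 1`. [folklore] -/
theorem fTerm_one (H : Finset ℕ) (s : ℂ) : fTerm H s 1 = 1 := by simp [fTerm, nu_one]

/-- `f(0) = 0` (Mathlib: `μ(0) = 0`). [folklore] -/
theorem fTerm_zero (H : Finset ℕ) (s : ℂ) : fTerm H s 0 = 0 := by simp [fTerm]

/-- `f` is multiplicative on coprime arguments (`μ`, `ν_·(H)` and `d ↦ d^{−1−s}` are).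
[cite: GoldstonPintzYildirim2009, Section 6 eq. 6.7] -/
theorem fTerm_mul (H : Finset ℕ) (s : ℂ) {a b : ℕ} (hab : a.Coprime b) :
    fTerm H s (a * b) = fTerm H s a * fTerm H s b := by
  unfold fTerm
  rw [ArithmeticFunction.isMultiplicative_moebius.map_mul_of_coprime hab, nu_mul_of_coprime H hab]
  push_cast
  rw [Complex.natCast_mul_natCast_cpow, div_mul_div_comm]
  ring

/-- `‖μ(d) ν_d(H) d^{−(1+s)}‖ ≤ k^{k²} d^{−(1/2+σ)}` (`k = |H| ≥ 1`), from `ν_d(H) ≤ k^{k²} √d` on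
squarefree `d`. [cite: GoldstonPintzYildirim2009, Section 6 eq. 6.7] -/
theorem norm_fTerm_le {H : Finset ℕ} (hH : H.Nonempty) (s : ℂ) (d : ℕ) :
    ‖fTerm H s d‖ ≤ (#H : ℝ) ^ (#H * #H) * (d : ℝ) ^ (-(1 / 2 + s.re)) := by
  rcases Nat.eq_zero_or_pos d with rfl | hd
  · rw [fTerm_zero, norm_zero]; positivity
  · have hd0 : (0 : ℝ) < d := by exact_mod_cast hd
    rw [fTerm, norm_div, norm_mul, Complex.norm_intCast, Complex.norm_natCast,
      Complex.norm_natCast_cpow_of_pos hd, Complex.add_re, Complex.one_re]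
    by_cases hsq : Squarefree d
    · have hμ : |((μ d : ℤ) : ℝ)| ≤ 1 := by exact_mod_cast ArithmeticFunction.abs_moebius_le_one
      have hν := nu_le_mul_sqrt hH hsq
      rw [div_le_iff₀ (by positivity)]
      calc |((μ d : ℤ) : ℝ)| * (nu H d : ℝ) ≤ 1 * ((#H : ℝ) ^ (#H * #H) * Real.sqrt d) :=
            mul_le_mul hμ hν (by positivity) zero_le_one
        _ = (#H : ℝ) ^ (#H * #H) * (d : ℝ) ^ (-(1 / 2 + s.re)) * (d : ℝ) ^ (1 + s.re) := by
            rw [one_mul, Real.sqrt_eq_rpow, mul_assoc, ← Real.rpow_add hd0]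
            congr 2; ring
    · rw [ArithmeticFunction.moebius_eq_zero_of_not_squarefree hsq]
      simp only [Int.cast_zero, abs_zero, zero_mul, zero_div]
      positivity

/-- `∑_d ‖μ(d) ν_d(H) d^{−(1+s)}‖ < ∞` for `Re s > 1/2`.
[cite: GoldstonPintzYildirim2009, Section 6 eq. 6.7] -/
theorem summable_norm_fTerm {H : Finset ℕ} (hH : H.Nonempty) {s : ℂ} (hs : 1 / 2 < s.re) :
    Summable fun d : ℕ => ‖fTerm H s d‖ :=
  Summable.of_nonneg_of_le (fun _ => norm_nonneg _) (norm_fTerm_le hH s)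
    ((Real.summable_nat_rpow.2 (by linarith)).mul_left _)

/-- The local factor: `∑_e μ(p^e) ν_{p^e}(H) p^{−e(1+s)} = 1 − ν_p(H) p^{−(1+s)}`.
[cite: GoldstonPintzYildirim2009, Section 6 eq. 6.7] -/
theorem tsum_fTerm_prime_pow (H : Finset ℕ) (s : ℂ) {p : ℕ} (hp : p.Prime) :
    ∑' e : ℕ, fTerm H s (p ^ e) = 1 - (nuPrime H p : ℂ) / (p : ℂ) ^ (1 + s) := by
  have h01 : ∀ e : ℕ, e ∉ ({0, 1} : Finset ℕ) → fTerm H s (p ^ e) = 0 := by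
    intro e he
    simp only [Finset.mem_insert, Finset.mem_singleton, not_or] at he
    rw [fTerm, ArithmeticFunction.moebius_apply_prime_pow hp he.1, if_neg he.2]
    simp
  rw [tsum_eq_sum h01, Finset.sum_pair (by norm_num), pow_zero, pow_one, fTerm_one, fTerm,
    ArithmeticFunction.moebius_apply_prime hp, nu_prime H hp]
  push_cast
  ring

/-- GPY's Euler factor of `F`: `1 − ν_p(H) p^{−(1+s)}`.
[cite: GoldstonPintzYildirim2009, Section 6 eq. 6.7] -/
def FFactor (H : Finset ℕ) (p : ℕ) (s : ℂ) : ℂ := 1 - (nuPrime H p : ℂ) / (p : ℂ) ^ (1 + s)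

/-- **GPY (6.7), Euler product**: `F(s) = ∏_p (1 − ν_p(H) p^{−(1+s)})` for `Re s > 1/2`
(unconditional product over `Nat.Primes`, Mathlib's `EulerProduct.eulerProduct_hasProd`).
[cite: GoldstonPintzYildirim2009, Section 6 eq. 6.7] -/
theorem hasProd_FFactor {H : Finset ℕ} (hH : H.Nonempty) {s : ℂ} (hs : 1 / 2 < s.re) :
    HasProd (fun p : Nat.Primes => FFactor H p s) (FDir H s) := by
  have h := EulerProduct.eulerProduct_hasProd (f := fTerm H s) (fTerm_one H s)
    (fun hab => fTerm_mul H s hab) (summable_norm_fTerm hH hs) (fTerm_zero H s)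
  have heq : (fun p : Nat.Primes => ∑' e : ℕ, fTerm H s ((p : ℕ) ^ e)) =
      fun p : Nat.Primes => FFactor H p s :=
    funext fun p => tsum_fTerm_prime_pow H s p.2
  rwa [heq] at h

/-! ### `G_H(s) = F(s) ζ(1+s)^k` ((6.8)–(6.9)) and `G_H(0) = 𝔖(H)` ((6.10)) -/

/-- GPY (6.9): the Euler factor of `G_H`, `(1 − ν_p(H) p^{−(1+s)}) (1 − p^{−(1+s)})^{−k}`.
[cite: GoldstonPintzYildirim2009, Section 6 eq. 6.9] -/
def GFactor (H : Finset ℕ) (p : ℕ) (s : ℂ) : ℂ :=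
  FFactor H p s * ((1 - (p : ℂ) ^ (-(1 + s)))⁻¹) ^ #H

/-- GPY (6.9): `G_H(s) = ∏_p (1 − ν_p(H) p^{−(1+s)}) (1 − p^{−(1+s)})^{−k}` (unconditional product
over the primes; it converges absolutely for `Re s > −1/2`).
[cite: GoldstonPintzYildirim2009, Section 6 eq. 6.9] -/
def GH (H : Finset ℕ) (s : ℂ) : ℂ := ∏' p : Nat.Primes, GFactor H p s

/-- `∏_p GFactor = F(s) ζ(1+s)^k` for `Re s > 1/2` (Euler products of `F` and of `ζ`).
[cite: GoldstonPintzYildirim2009, Section 6 eq. 6.8] -/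
theorem hasProd_GFactor {H : Finset ℕ} (hH : H.Nonempty) {s : ℂ} (hs : 1 / 2 < s.re) :
    HasProd (fun p : Nat.Primes => GFactor H p s) (FDir H s * riemannZeta (1 + s) ^ #H) := by
  have hζ := riemannZeta_eulerProduct_hasProd (s := 1 + s)
    (by simp only [Complex.add_re, Complex.one_re]; linarith)
  exact (hasProd_FFactor hH hs).mul (hζ.pow #H)

/-- **GPY (6.8)**: `G_H(s) = F(s) ζ(1+s)^k` for `Re s > 1/2`.
[cite: GoldstonPintzYildirim2009, Section 6 eq. 6.8] -/
theorem GH_eq_FDir_mul {H : Finset ℕ} (hH : H.Nonempty) {s : ℂ} (hs : 1 / 2 < s.re) :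
    GH H s = FDir H s * riemannZeta (1 + s) ^ #H :=
  (hasProd_GFactor hH hs).tprod_eq

/-- **GPY (6.8)**: `F(s) = G_H(s)/ζ(1+s)^k` for `Re s > 1/2`.
[cite: GoldstonPintzYildirim2009, Section 6 eq. 6.8] -/
theorem FDir_eq_GH_div {H : Finset ℕ} (hH : H.Nonempty) {s : ℂ} (hs : 1 / 2 < s.re) :
    FDir H s = GH H s / riemannZeta (1 + s) ^ #H := by
  have hζ : riemannZeta (1 + s) ≠ 0 :=
    riemannZeta_ne_zero_of_one_lt_re (by simp only [Complex.add_re, Complex.one_re]; linarith)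
  rw [GH_eq_FDir_mul hH hs, mul_div_cancel_right₀ _ (pow_ne_zero _ hζ)]

/-- At `s = 0` the factor of `G_H` is the Hardy–Littlewood factor `(1 − ν_p/p)(1 − 1/p)^{−k}` of the
cast tuple. [cite: GoldstonPintzYildirim2009, Section 6 eq. 6.10] -/
theorem GFactor_zero (H : Finset ℕ) {p : ℕ} (hp : p.Prime) :
    GFactor H p 0 = ((singularSeriesFactor (H.image ((↑) : ℕ → ℤ)) p : ℝ) : ℂ) := by
  rw [GFactor, FFactor, singularSeriesFactor, tupleResidueCount_image_cast hp,
    Finset.card_image_of_injective _ Nat.cast_injective, add_zero, Complex.cpow_one,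
    Complex.cpow_neg_one]
  push_cast
  ring

/-- **GPY (6.10)**: `G_H(0) = 𝔖(H)`. [cite: GoldstonPintzYildirim2009, Section 6 eq. 6.10] -/
theorem GH_zero (H : Finset ℕ) : GH H 0 = (singularSeriesNat H : ℂ) := by
  have h := (hasProd_singularSeriesFactor_holds (H.image ((↑) : ℕ → ℤ))).map Complex.ofRealHom
    Complex.continuous_ofReal
  have heq : (fun p : Nat.Primes => GFactor H p 0) =
      ⇑Complex.ofRealHom ∘ fun p : Nat.Primes => singularSeriesFactor (H.image ((↑) : ℕ → ℤ)) p :=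
    funext fun p => GFactor_zero H p.2
  rw [GH, heq, h.tprod_eq, singularSeriesNat]
  rfl

/-! ### Analyticity of `G_H` on `Re s > −1/2` ((6.9)) -/

/-- `ν_p(H) = k` as soon as all elements of `H` are `< p` (then they are distinct mod `p`).
[cite: GoldstonPintzYildirim2009, Section 6 eq. 6.13] -/
theorem nuPrime_eq_card {H : Finset ℕ} {p : ℕ} (hHp : ∀ h ∈ H, h < p) : nuPrime H p = #H := by
  unfold nuPrime
  refine Finset.card_image_of_injOn fun a ha b hb h => ?_
  have h' : a % p = b % p := h
  rwa [Nat.mod_eq_of_lt (hHp a ha), Nat.mod_eq_of_lt (hHp b hb)] at h'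

/-- The threshold `B_H = max (max H) (4k²)` beyond which the Euler factors of `G_H` are
`1 + O(k² p^{−2−2σ})`. [cite: GoldstonPintzYildirim2009, Section 6 eq. 6.9] -/
def tailBound (H : Finset ℕ) : ℕ := max (H.sup id) (4 * #H ^ 2)

/-- The elements of `H` are `< p` once `p > B_H`. [folklore] -/
theorem lt_of_tailBound_lt {H : Finset ℕ} {p : ℕ} (hp : tailBound H < p) : ∀ h ∈ H, h < p :=
  fun _ hh => lt_of_le_of_lt (Finset.le_sup (f := id) hh) ((le_max_left _ _).trans_lt hp)

/-- `4k² < p` once `p > B_H`. [folklore] -/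
theorem four_mul_sq_lt_of_tailBound_lt {H : Finset ℕ} {p : ℕ} (hp : tailBound H < p) :
    4 * #H ^ 2 < p :=
  (le_max_right _ _).trans_lt hp

/-- The logarithm of the tail factor: `log(1 − k p^{−(1+s)}) − k log(1 − p^{−(1+s)})`.
[cite: GoldstonPintzYildirim2009, Section 6 eq. 6.9] -/
def gLog (k p : ℕ) (s : ℂ) : ℂ :=
  Complex.log (1 - k * (p : ℂ) ^ (-(1 + s))) - k * Complex.log (1 - (p : ℂ) ^ (-(1 + s)))

/-- `|p^{−(1+s)}| = p^{−(1+σ)}`. [folklore] -/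
theorem norm_natCast_cpow_neg {p : ℕ} (hp : 0 < p) (s : ℂ) :
    ‖(p : ℂ) ^ (-(1 + s))‖ = (p : ℝ) ^ (-(1 + s.re)) := by
  rw [Complex.norm_natCast_cpow_of_pos hp]; simp

/-- For `p > 4k²` and `σ ≥ −1/2`: `k |p^{−(1+s)}| ≤ k p^{−1/2} ≤ 1/2` ("if `p > U`,
`|k p^{−1−s}| ≤ k U^{−(1−δ)} ≤ 1/2`", GPY p. 13).
[cite: GoldstonPintzYildirim2009, Section 6 eq. 6.16] -/
theorem card_mul_norm_le_half {k p : ℕ} (hp : 4 * k ^ 2 < p) {s : ℂ} (hs : -1 / 2 ≤ s.re) :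
    (k : ℝ) * ‖(p : ℂ) ^ (-(1 + s))‖ ≤ 1 / 2 := by
  have hp0 : 0 < p := by omega
  rw [norm_natCast_cpow_neg hp0]
  have h1 : (p : ℝ) ^ (-(1 + s.re)) ≤ (p : ℝ) ^ (-(1 / 2 : ℝ)) :=
    Real.rpow_le_rpow_of_exponent_le (by exact_mod_cast hp0) (by linarith)
  have h2 : (k : ℝ) ≤ Real.sqrt p / 2 := by
    rw [le_div_iff₀ two_pos, Real.le_sqrt (by positivity) (by positivity)]
    have : ((4 * k ^ 2 : ℕ) : ℝ) ≤ p := by exact_mod_cast hp.le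
    push_cast at this; nlinarith
  calc (k : ℝ) * (p : ℝ) ^ (-(1 + s.re)) ≤ Real.sqrt p / 2 * (p : ℝ) ^ (-(1 / 2 : ℝ)) :=
        mul_le_mul h2 h1 (by positivity) (by positivity)
    _ = 1 / 2 := by
        rw [div_mul_eq_mul_div, Real.sqrt_eq_rpow, ← Real.rpow_add (by exact_mod_cast hp0),
          show (1 / 2 : ℝ) + -(1 / 2) = 0 by ring, Real.rpow_zero]

/-- `|w| ≤ 1/2 ⟹ 1 − w ≠ 0`. [folklore] -/
theorem one_sub_ne_zero_of_norm_le_half {w : ℂ} (hw : ‖w‖ ≤ 1 / 2) : 1 - w ≠ 0 := by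
  intro h
  have : w = 1 := by linear_combination -h
  rw [this, norm_one] at hw
  norm_num at hw

/-- `|w| ≤ 1/2 ⟹ Re(1 − w) > 0` (so `1 − w` is in the slit plane of `Complex.log`). [folklore] -/
theorem re_one_sub_pos_of_norm_le_half {w : ℂ} (hw : ‖w‖ ≤ 1 / 2) : 0 < (1 - w).re := by
  have h := (abs_le.1 ((Complex.abs_re_le_norm w).trans hw)).2
  simp only [Complex.sub_re, Complex.one_re]
  linarith

/-- `exp(gLog) = (1 − k z)(1 − z)^{−k}`, `z = p^{−(1+s)}`, when `k|z| ≤ 1/2`, `k ≥ 1`.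
[cite: GoldstonPintzYildirim2009, Section 6 eq. 6.9] -/
theorem exp_gLog {k p : ℕ} {s : ℂ} (h : (k : ℝ) * ‖(p : ℂ) ^ (-(1 + s))‖ ≤ 1 / 2) (hk : 1 ≤ k) :
    Complex.exp (gLog k p s) =
      (1 - k * (p : ℂ) ^ (-(1 + s))) * ((1 - (p : ℂ) ^ (-(1 + s)))⁻¹) ^ k := by
  set z := (p : ℂ) ^ (-(1 + s)) with hz
  have hkz : ‖(k : ℂ) * z‖ ≤ 1 / 2 := by rwa [norm_mul, Complex.norm_natCast]
  have hz1 : ‖z‖ ≤ 1 / 2 :=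
    le_trans (le_mul_of_one_le_left (norm_nonneg _) (by exact_mod_cast hk)) h
  rw [gLog, Complex.exp_sub, Complex.exp_log (one_sub_ne_zero_of_norm_le_half hkz),
    Complex.exp_nat_mul, Complex.exp_log (one_sub_ne_zero_of_norm_le_half hz1), div_eq_mul_inv,
    inv_pow]

/-- `‖gLog‖ ≤ 2k² |p^{−(1+s)}|²` when `k|p^{−(1+s)}| ≤ 1/2`, `k ≥ 1`: the factors of `G_H` are
`1 + O(k² p^{−2−2σ})` (by the tree's `Literature.NumberTheory.LFunctions.norm_neg_log_one_sub_sub_le`,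
`‖−log(1−z) − z‖ ≤ ‖z‖²` for `‖z‖ ≤ 1/2`). [cite: GoldstonPintzYildirim2009, Section 6 eq. 6.9] -/
theorem norm_gLog_le {k p : ℕ} {s : ℂ} (h : (k : ℝ) * ‖(p : ℂ) ^ (-(1 + s))‖ ≤ 1 / 2) (hk : 1 ≤ k) :
    ‖gLog k p s‖ ≤ 2 * (k : ℝ) ^ 2 * ‖(p : ℂ) ^ (-(1 + s))‖ ^ 2 := by
  set z := (p : ℂ) ^ (-(1 + s)) with hz
  have hkz : ‖(k : ℂ) * z‖ ≤ 1 / 2 := by rwa [norm_mul, Complex.norm_natCast]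
  have hk1 : (1 : ℝ) ≤ k := by exact_mod_cast hk
  have hz1 : ‖z‖ ≤ 1 / 2 := le_trans (le_mul_of_one_le_left (norm_nonneg _) hk1) h
  have e1 : ‖Complex.log (1 - k * z) + k * z‖ ≤ ‖(k : ℂ) * z‖ ^ 2 := by
    rw [show Complex.log (1 - k * z) + k * z = -(-Complex.log (1 - k * z) - k * z) by ring,
      norm_neg]
    exact Literature.NumberTheory.LFunctions.norm_neg_log_one_sub_sub_le hkz
  have e2 : ‖Complex.log (1 - z) + z‖ ≤ ‖z‖ ^ 2 := by
    rw [show Complex.log (1 - z) + z = -(-Complex.log (1 - z) - z) by ring, norm_neg]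
    exact Literature.NumberTheory.LFunctions.norm_neg_log_one_sub_sub_le hz1
  calc ‖gLog k p s‖
      = ‖(Complex.log (1 - k * z) + k * z) - k * (Complex.log (1 - z) + z)‖ := by
        rw [gLog]; congr 1; ring
    _ ≤ ‖Complex.log (1 - k * z) + k * z‖ + ‖(k : ℂ) * (Complex.log (1 - z) + z)‖ :=
        norm_sub_le _ _
    _ ≤ ‖(k : ℂ) * z‖ ^ 2 + k * ‖z‖ ^ 2 := by
        refine add_le_add e1 ?_
        rw [norm_mul, Complex.norm_natCast]
        exact mul_le_mul_of_nonneg_left e2 (by positivity)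
    _ = (k : ℝ) ^ 2 * ‖z‖ ^ 2 + k * ‖z‖ ^ 2 := by rw [norm_mul, Complex.norm_natCast]; ring
    _ ≤ 2 * (k : ℝ) ^ 2 * ‖z‖ ^ 2 := by
        have hkk : (k : ℝ) * ‖z‖ ^ 2 ≤ (k : ℝ) ^ 2 * ‖z‖ ^ 2 :=
          mul_le_mul_of_nonneg_right (by nlinarith) (sq_nonneg _)
        linarith

/-- `s ↦ p^{−(1+s)}` is entire (`p ≥ 1`). [folklore] -/
theorem differentiableAt_cpow_neg {p : ℕ} (hp : 0 < p) (s : ℂ) :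
    DifferentiableAt ℂ (fun s : ℂ => (p : ℂ) ^ (-(1 + s))) s :=
  ((differentiableAt_id.const_add (1 : ℂ)).neg).const_cpow (Or.inl (by exact_mod_cast hp.ne'))

/-- `gLog` is holomorphic where `k|p^{−(1+s)}| ≤ 1/2` (the logarithms stay in the right
half-plane). [cite: GoldstonPintzYildirim2009, Section 6 eq. 6.9] -/
theorem differentiableAt_gLog {k p : ℕ} (hp : 0 < p) {s : ℂ}
    (h : (k : ℝ) * ‖(p : ℂ) ^ (-(1 + s))‖ ≤ 1 / 2) (hk : 1 ≤ k) :
    DifferentiableAt ℂ (gLog k p) s := by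
  have hd := differentiableAt_cpow_neg hp s
  have hkz : ‖(k : ℂ) * (p : ℂ) ^ (-(1 + s))‖ ≤ 1 / 2 := by rwa [norm_mul, Complex.norm_natCast]
  have hz1 : ‖(p : ℂ) ^ (-(1 + s))‖ ≤ 1 / 2 :=
    le_trans (le_mul_of_one_le_left (norm_nonneg _) (by exact_mod_cast hk)) h
  unfold gLog
  refine (((differentiableAt_const _).sub (hd.const_mul _)).clog ?_).sub
    ((((differentiableAt_const _).sub hd).clog ?_).const_mul _)
  · exact Complex.mem_slitPlane_iff.2 (Or.inl (re_one_sub_pos_of_norm_le_half hkz))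
  · exact Complex.mem_slitPlane_iff.2 (Or.inl (re_one_sub_pos_of_norm_le_half hz1))

/-- Each Euler factor of `G_H` is holomorphic on `Re s > −1`.
[cite: GoldstonPintzYildirim2009, Section 6 eq. 6.9] -/
theorem differentiableAt_GFactor (H : Finset ℕ) {p : ℕ} (hp : p.Prime) {s : ℂ} (hs : -1 < s.re) :
    DifferentiableAt ℂ (GFactor H p) s := by
  have hp0 : 0 < p := hp.pos
  have hd := differentiableAt_cpow_neg hp0 s
  have hd' : DifferentiableAt ℂ (fun s : ℂ => (p : ℂ) ^ (1 + s)) s :=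
    (differentiableAt_id.const_add (1 : ℂ)).const_cpow (Or.inl (by exact_mod_cast hp0.ne'))
  have hne : (p : ℂ) ^ (1 + s) ≠ 0 :=
    Complex.cpow_ne_zero_iff.2 (Or.inl (by exact_mod_cast hp0.ne'))
  have hz1 : ‖(p : ℂ) ^ (-(1 + s))‖ < 1 := by
    rw [norm_natCast_cpow_neg hp0]
    exact Real.rpow_lt_one_of_one_lt_of_neg (by exact_mod_cast hp.one_lt) (by linarith)
  have hne' : 1 - (p : ℂ) ^ (-(1 + s)) ≠ 0 := fun h0 => by
    have : (p : ℂ) ^ (-(1 + s)) = 1 := by linear_combination -h0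
    rw [this, norm_one] at hz1
    exact lt_irrefl _ hz1
  unfold GFactor FFactor
  exact ((differentiableAt_const _).sub ((differentiableAt_const _).div hd' hne)).mul
    ((((differentiableAt_const _).sub hd).inv hne').pow _)

/-- The primes `≤ B`, as a `Finset Nat.Primes`. [folklore] -/
def smallPrimes (B : ℕ) : Finset Nat.Primes := (Finset.range (B + 1)).subtype Nat.Prime

/-- Membership in `smallPrimes B`. [folklore] -/
theorem mem_smallPrimes {B : ℕ} {p : Nat.Primes} : p ∈ smallPrimes B ↔ (p : ℕ) ≤ B :=
  (Finset.mem_subtype (s := Finset.range (B + 1)) (a := p)).trans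
    (by rw [Finset.mem_range]; exact Nat.lt_succ_iff)

/-- The logarithms of the tail factors (`0` for `p ≤ B_H`).
[cite: GoldstonPintzYildirim2009, Section 6 eq. 6.9] -/
def gTail (H : Finset ℕ) (p : Nat.Primes) (s : ℂ) : ℂ :=
  if (p : ℕ) ≤ tailBound H then 0 else gLog #H p s

/-- For `p > B_H` and `σ ≥ −1/2` the factor of `G_H` is `exp(gLog)` (`ν_p(H) = k` there).
[cite: GoldstonPintzYildirim2009, Section 6 eq. 6.9] -/
theorem GFactor_eq_exp_gLog {H : Finset ℕ} (hH : H.Nonempty) {p : ℕ} (hp : tailBound H < p)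
    {s : ℂ} (hs : -1 / 2 ≤ s.re) : GFactor H p s = Complex.exp (gLog #H p s) := by
  have h := card_mul_norm_le_half (four_mul_sq_lt_of_tailBound_lt hp) hs
  rw [exp_gLog h hH.card_pos, GFactor, FFactor, nuPrime_eq_card (lt_of_tailBound_lt hp),
    div_eq_mul_inv, ← Complex.cpow_neg]

/-- `∑_p 2k² p^{−1−2δ} < ∞` for `δ > 0`. [folklore] -/
theorem summable_tail_majorant (H : Finset ℕ) {δ : ℝ} (hδ : 0 < δ) :
    Summable fun p : Nat.Primes => 2 * (#H : ℝ) ^ 2 * (p : ℝ) ^ (-(1 + 2 * δ)) :=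
  (Nat.Primes.summable_rpow.2 (by linarith)).mul_left _

/-- Uniform majorant on `Re s > −1/2 + δ`, `p > B_H`: `‖gLog_p(s)‖ ≤ 2k² p^{−1−2δ}`.
[cite: GoldstonPintzYildirim2009, Section 6 eq. 6.9] -/
theorem norm_gLog_le_rpow {H : Finset ℕ} (hH : H.Nonempty) {δ : ℝ} (hδ : 0 < δ) {s : ℂ}
    (hs : -1 / 2 + δ < s.re) {p : ℕ} (hp : tailBound H < p) :
    ‖gLog #H p s‖ ≤ 2 * (#H : ℝ) ^ 2 * (p : ℝ) ^ (-(1 + 2 * δ)) := by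
  have hp0 : 0 < p := by have := four_mul_sq_lt_of_tailBound_lt hp; omega
  have h := card_mul_norm_le_half (four_mul_sq_lt_of_tailBound_lt hp) (s := s) (by linarith)
  refine (norm_gLog_le h hH.card_pos).trans ?_
  have hp1 : (1 : ℝ) ≤ p := by exact_mod_cast hp0
  have e : ‖(p : ℂ) ^ (-(1 + s))‖ ^ 2 = (p : ℝ) ^ (-(1 + s.re) + -(1 + s.re)) := by
    rw [norm_natCast_cpow_neg hp0, sq, ← Real.rpow_add (by positivity)]
  rw [e]
  have hexp : (p : ℝ) ^ (-(1 + s.re) + -(1 + s.re)) ≤ (p : ℝ) ^ (-(1 + 2 * δ)) :=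
    Real.rpow_le_rpow_of_exponent_le hp1 (by linarith)
  gcongr

/-- Uniform majorant on `Re s > −1/2 + δ`: `‖gTail p s‖ ≤ 2k² p^{−1−2δ}`.
[cite: GoldstonPintzYildirim2009, Section 6 eq. 6.9] -/
theorem norm_gTail_le {H : Finset ℕ} (hH : H.Nonempty) {δ : ℝ} (hδ : 0 < δ) {s : ℂ}
    (hs : -1 / 2 + δ < s.re) (p : Nat.Primes) :
    ‖gTail H p s‖ ≤ 2 * (#H : ℝ) ^ 2 * (p : ℝ) ^ (-(1 + 2 * δ)) := by
  unfold gTail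
  split_ifs with hp
  · rw [norm_zero]; positivity
  · rw [not_le] at hp
    exact norm_gLog_le_rpow hH hδ hs hp

/-- Each `gTail p` is holomorphic on `Re s > −1/2 + δ`.
[cite: GoldstonPintzYildirim2009, Section 6 eq. 6.9] -/
theorem differentiableOn_gTail {H : Finset ℕ} (hH : H.Nonempty) {δ : ℝ} (hδ : 0 < δ)
    (p : Nat.Primes) : DifferentiableOn ℂ (gTail H p) {s : ℂ | -1 / 2 + δ < s.re} := by
  intro s hs
  have hs' : -1 / 2 + δ < s.re := hs
  by_cases hp : (p : ℕ) ≤ tailBound H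
  · have : gTail H p = fun _ => 0 := funext fun s => if_pos hp
    rw [this]
    exact (differentiableAt_const _).differentiableWithinAt
  · have : gTail H p = gLog #H p := funext fun s => if_neg hp
    rw [this]
    rw [not_le] at hp
    have h := card_mul_norm_le_half (four_mul_sq_lt_of_tailBound_lt hp) (s := s) (by linarith)
    exact (differentiableAt_gLog p.2.pos h hH.card_pos).differentiableWithinAt

/-- `∑_p gTail_p(s)` converges absolutely for `Re s > −1/2`.
[cite: GoldstonPintzYildirim2009, Section 6 eq. 6.9] -/
theorem summable_gTail {H : Finset ℕ} (hH : H.Nonempty) {s : ℂ} (hs : -1 / 2 < s.re) :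
    Summable fun p : Nat.Primes => gTail H p s := by
  set δ := (s.re + 1 / 2) / 2 with hδ
  have hδ0 : 0 < δ := by linarith
  exact Summable.of_norm_bounded (summable_tail_majorant H hδ0)
    (fun p => norm_gTail_le hH hδ0 (by linarith) p)

/-- `G_H(s) = ∏_{p ≤ B_H} GFactor_p(s) · exp(∑_{p > B_H} gLog_p(s))` for `Re s > −1/2`: the Euler
product of `G_H` converges (absolutely) there.
[cite: GoldstonPintzYildirim2009, Section 6 eq. 6.9] -/
theorem hasProd_GFactor_of_re {H : Finset ℕ} (hH : H.Nonempty) {s : ℂ} (hs : -1 / 2 < s.re) :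
    HasProd (fun p : Nat.Primes => GFactor H p s)
      ((∏ p ∈ smallPrimes (tailBound H), GFactor H p s) *
        Complex.exp (∑' p : Nat.Primes, gTail H p s)) := by
  set B := tailBound H with hB
  have hA : HasProd (fun p : Nat.Primes => if (p : ℕ) ≤ B then GFactor H p s else 1)
      (∏ p ∈ smallPrimes B, GFactor H p s) := by
    have h : HasProd (fun p : Nat.Primes => if (p : ℕ) ≤ B then GFactor H p s else 1)
        (∏ p ∈ smallPrimes B, (if (p : ℕ) ≤ B then GFactor H p s else 1)) :=
      hasProd_prod_of_ne_finset_one (fun p hp => if_neg (mt mem_smallPrimes.2 hp))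
    rwa [Finset.prod_congr rfl (fun p hp => if_pos (mem_smallPrimes.1 hp))] at h
  have hE : HasProd (fun p : Nat.Primes => Complex.exp (gTail H p s))
      (Complex.exp (∑' p : Nat.Primes, gTail H p s)) :=
    (summable_gTail hH hs).hasSum.cexp
  have h := hA.mul hE
  convert h using 1
  funext p
  by_cases hp : (p : ℕ) ≤ B
  · simp [gTail, ← hB, hp]
  · rw [if_neg hp, one_mul, gTail, ← hB, if_neg hp, GFactor_eq_exp_gLog hH (not_le.1 hp) hs.le]

/-- `G_H(s) = ∏_{p ≤ B_H} GFactor_p(s) · exp(∑_p gTail_p(s))` for `Re s > −1/2`.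
[cite: GoldstonPintzYildirim2009, Section 6 eq. 6.9] -/
theorem GH_eq_prod_mul_exp {H : Finset ℕ} (hH : H.Nonempty) {s : ℂ} (hs : -1 / 2 < s.re) :
    GH H s = (∏ p ∈ smallPrimes (tailBound H), GFactor H p s) *
      Complex.exp (∑' p : Nat.Primes, gTail H p s) :=
  (hasProd_GFactor_of_re hH hs).tprod_eq

/-- The Euler product of `G_H` converges for `Re s > −1/2`.
[cite: GoldstonPintzYildirim2009, Section 6 eq. 6.9] -/
theorem multipliable_GFactor {H : Finset ℕ} (hH : H.Nonempty) {s : ℂ} (hs : -1 / 2 < s.re) :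
    Multipliable fun p : Nat.Primes => GFactor H p s :=
  ⟨_, hasProd_GFactor_of_re hH hs⟩

/-- **GPY (6.9)**: `G_H` is holomorphic on `Re s > −1/2`.
[cite: GoldstonPintzYildirim2009, Section 6 eq. 6.9] -/
theorem differentiableOn_GH {H : Finset ℕ} (hH : H.Nonempty) :
    DifferentiableOn ℂ (GH H) {s : ℂ | -1 / 2 < s.re} := by
  intro s hs
  have hs' : -1 / 2 < s.re := hs
  set δ := (s.re + 1 / 2) / 2 with hδ
  have hδ0 : 0 < δ := by linarith
  set U : Set ℂ := {w : ℂ | -1 / 2 + δ < w.re} with hU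
  have hUo : IsOpen U := isOpen_lt continuous_const Complex.continuous_re
  have hsU : s ∈ U := by show -1 / 2 + δ < s.re; linarith
  have hsub : ∀ w ∈ U, -1 / 2 < w.re := fun w hw => by
    have : -1 / 2 + δ < w.re := hw
    linarith
  have hdiff : DifferentiableOn ℂ (fun w => (∏ p ∈ smallPrimes (tailBound H), GFactor H p w) *
      Complex.exp (∑' p : Nat.Primes, gTail H p w)) U := by
    refine DifferentiableOn.mul ?_ ?_
    · have h := DifferentiableOn.finsetProd (u := smallPrimes (tailBound H))
        (f := fun (p : Nat.Primes) (w : ℂ) => GFactor H p w) (s := U)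
        (fun p _ => fun w hw => (differentiableAt_GFactor H p.2
          (by linarith [hsub w hw])).differentiableWithinAt)
      exact h.congr fun w _ => (Finset.prod_apply w _ _).symm
    · exact (differentiableOn_tsum_of_summable_norm (summable_tail_majorant H hδ0)
        (fun p => differentiableOn_gTail hH hδ0 p) hUo
        (fun p w hw => norm_gTail_le hH hδ0 hw p)).cexp
  have hGU : DifferentiableOn ℂ (GH H) U :=
    hdiff.congr fun w hw => GH_eq_prod_mul_exp hH (hsub w hw)
  exact (hGU.differentiableAt (hUo.mem_nhds hsU)).differentiableWithinAt

/-! ## GPY (6.13)–(6.16): the bound for `G_H` on `σ ≥ −1/4` -/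

/-- GPY (6.13): `Δ(H) = ∏_{hᵢ < hⱼ ∈ H} (hⱼ − hᵢ)` (a natural number `≥ 1`).
[cite: GoldstonPintzYildirim2009, Section 6 eq. 6.13] -/
def discr (H : Finset ℕ) : ℕ := ∏ a ∈ H, ∏ b ∈ H.filter (a < ·), (b - a)

/-- `Δ(H) ≥ 1`. [cite: GoldstonPintzYildirim2009, Section 6 eq. 6.13] -/
theorem discr_pos (H : Finset ℕ) : 0 < discr H :=
  Finset.prod_pos fun a _ => Finset.prod_pos fun b hb => by
    have := (Finset.mem_filter.1 hb).2; omega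

/-- `b − a ∣ Δ(H)` for `a < b` in `H`. [cite: GoldstonPintzYildirim2009, Section 6 eq. 6.13] -/
theorem sub_dvd_discr {H : Finset ℕ} {a b : ℕ} (ha : a ∈ H) (hb : b ∈ H) (hab : a < b) :
    b - a ∣ discr H := by
  have h1 : b - a ∣ ∏ c ∈ H.filter (a < ·), (c - a) :=
    Finset.dvd_prod_of_mem (fun c => c - a) (Finset.mem_filter.2 ⟨hb, hab⟩)
  exact h1.trans (Finset.dvd_prod_of_mem (fun x => ∏ c ∈ H.filter (x < ·), (c - x)) ha)

/-- "`ν_p(H) = k` not only when `p > h`, but whenever `p ∤ Δ`, since then all `k` of the `hᵢ` are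
distinct modulo `p`." [cite: GoldstonPintzYildirim2009, Section 6 eq. 6.13] -/
theorem nuPrime_eq_card_of_not_dvd {H : Finset ℕ} {p : ℕ} (hΔ : ¬ p ∣ discr H) :
    nuPrime H p = #H := by
  unfold nuPrime
  refine Finset.card_image_of_injOn fun a ha b hb h => ?_
  have h' : a % p = b % p := h
  by_contra hne
  rcases lt_or_gt_of_ne hne with hlt | hlt
  · exact hΔ ((Nat.dvd_of_mod_eq_zero (Nat.sub_mod_eq_zero_of_mod_eq h'.symm)).trans
      (sub_dvd_discr ha hb hlt))
  · exact hΔ ((Nat.dvd_of_mod_eq_zero (Nat.sub_mod_eq_zero_of_mod_eq h')).trans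
      (sub_dvd_discr hb ha hlt))

/-- `Δ(H) ≤ h^{k(k−1)/2} ≤ h^{k²}` when `H ⊆ [0, h]`… here in the form `Δ(H) ≤ h^{#pairs}` with
`#pairs ≤ k²`: `Δ ≤ (max 1 h)^{k²}`. [cite: GoldstonPintzYildirim2009, Section 6 eq. 6.14] -/
theorem discr_le_pow {H : Finset ℕ} {h : ℕ} (hh : ∀ x ∈ H, x ≤ h) :
    discr H ≤ (max 1 h) ^ (#H * #H) := by
  unfold discr
  calc ∏ a ∈ H, ∏ b ∈ H.filter (a < ·), (b - a)
      ≤ ∏ a ∈ H, ∏ _b ∈ H.filter (a < ·), max 1 h :=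
        Finset.prod_le_prod' fun a _ => Finset.prod_le_prod' fun b hb => by
          have := hh b (Finset.mem_filter.1 hb).1
          exact le_trans (by omega) (le_max_right 1 h)
    _ = ∏ a ∈ H, (max 1 h) ^ #(H.filter (a < ·)) := by simp
    _ ≤ ∏ _a ∈ H, (max 1 h) ^ #H :=
        Finset.prod_le_prod' fun a _ =>
          Nat.pow_le_pow_right (le_max_left 1 h |> fun h1 => h1) (Finset.card_filter_le _ _)
    _ = (max 1 h) ^ (#H * #H) := by rw [Finset.prod_const, ← pow_mul, mul_comm]

/-- `2^{ω(n)} ≤ n` for `n ≥ 1`: the number of prime factors is at most `log₂ n`. [folklore] -/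
theorem two_pow_card_primeFactors_le {n : ℕ} (hn : n ≠ 0) : 2 ^ n.primeFactors.card ≤ n := by
  calc 2 ^ n.primeFactors.card = ∏ _p ∈ n.primeFactors, 2 := by rw [Finset.prod_const]
    _ ≤ ∏ p ∈ n.primeFactors, p :=
        Finset.prod_le_prod' fun p hp => (Nat.prime_of_mem_primeFactors hp).two_le
    _ ≤ n := Nat.le_of_dvd (Nat.pos_of_ne_zero hn) (Nat.prod_primeFactors_dvd n)


/-! ### GPY's parameter `U` ((6.14)) -/

/-- GPY (6.14): `U = C k² log(2h)`; here with `C = 1` and the floor `max(16, 4k²)`: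
`U = max(16, 4k², k² log(2h))`, which gives `log Δ ≤ U` ((6.15)), `U ≥ 16` and `2k ≤ √U`.
[cite: GoldstonPintzYildirim2009, Section 6 eq. 6.14] -/
def gpyU (k h : ℕ) : ℝ := max (max 16 (4 * (k : ℝ) ^ 2)) ((k : ℝ) ^ 2 * Real.log (2 * h))

/-- `U ≥ 16`. [cite: GoldstonPintzYildirim2009, Section 6 eq. 6.14] -/
theorem sixteen_le_gpyU (k h : ℕ) : 16 ≤ gpyU k h := (le_max_left _ _).trans (le_max_left _ _)

/-- `U ≥ 4k²`. [cite: GoldstonPintzYildirim2009, Section 6 eq. 6.14] -/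
theorem four_mul_sq_le_gpyU (k h : ℕ) : 4 * (k : ℝ) ^ 2 ≤ gpyU k h :=
  (le_max_right _ _).trans (le_max_left _ _)

/-- `U > 0`. [cite: GoldstonPintzYildirim2009, Section 6 eq. 6.14] -/
theorem gpyU_pos (k h : ℕ) : 0 < gpyU k h := lt_of_lt_of_le (by norm_num) (sixteen_le_gpyU k h)

/-- `U ≥ k² log(2h)`. [cite: GoldstonPintzYildirim2009, Section 6 eq. 6.14] -/
theorem sq_mul_log_le_gpyU (k h : ℕ) : (k : ℝ) ^ 2 * Real.log (2 * h) ≤ gpyU k h := le_max_right _ _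

/-- GPY (6.15): `log Δ ≤ U`. [cite: GoldstonPintzYildirim2009, Section 6 eq. 6.15] -/
theorem log_discr_le_gpyU {H : Finset ℕ} {h : ℕ} (hh : ∀ x ∈ H, x ≤ h) :
    Real.log (discr H) ≤ gpyU #H h := by
  have hΔ := discr_le_pow hh
  have h1 : Real.log (discr H) ≤ (#H * #H : ℕ) * Real.log (max 1 h : ℕ) := by
    rw [← Real.log_pow]
    exact Real.log_le_log (by exact_mod_cast discr_pos H) (by exact_mod_cast hΔ)
  refine h1.trans (le_trans ?_ (sq_mul_log_le_gpyU #H h))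
  rcases Nat.eq_zero_or_pos h with rfl | hpos
  · simp
  · rw [max_eq_right hpos]
    push_cast
    rw [← sq]
    exact mul_le_mul_of_nonneg_left (Real.log_le_log (by exact_mod_cast hpos)
      (by exact_mod_cast (by omega : h ≤ 2 * h))) (by positivity)

/-- `2k ≤ √U`. [cite: GoldstonPintzYildirim2009, Section 6 eq. 6.14] -/
theorem two_mul_card_le_sqrt_gpyU (k h : ℕ) : 2 * (k : ℝ) ≤ Real.sqrt (gpyU k h) := by
  rw [Real.le_sqrt (by positivity) (gpyU_pos k h).le]
  nlinarith [four_mul_sq_le_gpyU k h]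

/-- `k x ≤ 1/2` where `x = p^{−(1+σ)}`, for `p > U`, `σ ≥ −1/4` ("if `p > U`,
`|k p^{−1−s}| ≤ k U^{−(1−δ)} ≤ 1/2`"). [cite: GoldstonPintzYildirim2009, Section 6 eq. 6.16] -/
theorem card_mul_rpow_le_half {k h p : ℕ} (hp : gpyU k h < p) {σ : ℝ} (hσ : -1 / 4 ≤ σ) :
    (k : ℝ) * (p : ℝ) ^ (-(1 + σ)) ≤ 1 / 2 := by
  have hU := gpyU_pos k h
  have hU1 : (1 : ℝ) ≤ gpyU k h := by linarith [sixteen_le_gpyU k h]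
  have hp1 : (1 : ℝ) ≤ p := hU1.trans hp.le
  -- `p^{-(1+σ)} ≤ p^{-3/4} ≤ U^{-3/4} ≤ U^{-1/2} = 1/√U`
  have h1 : (p : ℝ) ^ (-(1 + σ)) ≤ (p : ℝ) ^ (-(3 / 4 : ℝ)) :=
    Real.rpow_le_rpow_of_exponent_le hp1 (by linarith)
  have h2 : (p : ℝ) ^ (-(3 / 4 : ℝ)) ≤ gpyU k h ^ (-(3 / 4 : ℝ)) :=
    Real.rpow_le_rpow_of_nonpos hU hp.le (by norm_num)
  have h3 : gpyU k h ^ (-(3 / 4 : ℝ)) ≤ gpyU k h ^ (-(1 / 2 : ℝ)) :=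
    Real.rpow_le_rpow_of_exponent_le hU1 (by norm_num)
  have h4 : gpyU k h ^ (-(1 / 2 : ℝ)) = (Real.sqrt (gpyU k h))⁻¹ := by
    rw [Real.rpow_neg hU.le, Real.sqrt_eq_rpow]
  have hsqrt : 0 < Real.sqrt (gpyU k h) := Real.sqrt_pos.2 hU
  have hk := two_mul_card_le_sqrt_gpyU k h
  calc (k : ℝ) * (p : ℝ) ^ (-(1 + σ)) ≤ (Real.sqrt (gpyU k h) / 2) * (Real.sqrt (gpyU k h))⁻¹ := by
        rw [← h4]
        exact mul_le_mul (by linarith) (h1.trans (h2.trans h3)) (by positivity) (by positivity)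
    _ = 1 / 2 := by field_simp


/-! ### Bounds for the Euler factors of `G_H` ((6.16), the pieces) -/

/-- Numeric: `2^{−3/4} ≤ 2/3` (GPY use `1/p^{1−δ} ≤ 2^{−3/4} < 2/3`).
[cite: GoldstonPintzYildirim2009, Section 6 eq. 6.16] -/
theorem two_rpow_neg_three_quarters_le : (2 : ℝ) ^ (-(3 / 4 : ℝ)) ≤ 2 / 3 := by
  have h : ((3 / 2 : ℝ) ^ 4) ^ ((4 : ℕ) : ℝ)⁻¹ ≤ ((2 : ℝ) ^ 3) ^ ((4 : ℕ) : ℝ)⁻¹ :=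
    Real.rpow_le_rpow (by positivity) (by norm_num) (by positivity)
  rw [Real.pow_rpow_inv_natCast (by norm_num) (by norm_num)] at h
  have e : ((2 : ℝ) ^ 3) ^ ((4 : ℕ) : ℝ)⁻¹ = 2 ^ (3 / 4 : ℝ) := by
    rw [← Real.rpow_natCast 2 3, ← Real.rpow_mul zero_le_two]; norm_num
  rw [e] at h
  rw [Real.rpow_neg zero_le_two, inv_le_comm₀ (by positivity) (by norm_num)]
  calc (2 / 3 : ℝ)⁻¹ = 3 / 2 := by norm_num
    _ ≤ 2 ^ (3 / 4 : ℝ) := h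

/-- For every prime `p` and `σ ≥ −1/4`, with `x = p^{−(1+σ)} (≤ 2^{−3/4} < 2/3)`:
`|(1 − ν_p p^{−1−s})(1 − p^{−1−s})^{−k}| ≤ (1 + kx)(1 + 3x)^k ≤ e^{4kx}` ("by the inequality
`(1−x)^{−1} ≤ 1 + 3x` for `0 ≤ x ≤ 2/3`"). [cite: GoldstonPintzYildirim2009, Section 6 eq. 6.16] -/
theorem norm_GFactor_le_exp (H : Finset ℕ) {p : ℕ} (hp : p.Prime) {s : ℂ} (hs : -1 / 4 ≤ s.re) :
    ‖GFactor H p s‖ ≤ Real.exp (4 * #H * (p : ℝ) ^ (-(1 + s.re))) := by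
  set x : ℝ := (p : ℝ) ^ (-(1 + s.re)) with hxdef
  have hp0 := hp.pos
  have hzx : ‖(p : ℂ) ^ (-(1 + s))‖ = x := norm_natCast_cpow_neg hp0 s
  have hx0 : 0 ≤ x := by positivity
  have hx23 : x ≤ 2 / 3 := by
    calc x ≤ (p : ℝ) ^ (-(3 / 4 : ℝ)) :=
          Real.rpow_le_rpow_of_exponent_le (by exact_mod_cast hp.one_lt.le) (by linarith)
      _ ≤ (2 : ℝ) ^ (-(3 / 4 : ℝ)) :=
          Real.rpow_le_rpow_of_nonpos (by norm_num) (by exact_mod_cast hp.two_le) (by norm_num)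
      _ ≤ 2 / 3 := two_rpow_neg_three_quarters_le
  -- first factor
  have h1 : ‖FFactor H p s‖ ≤ Real.exp (#H * x) := by
    unfold FFactor
    calc ‖1 - (nuPrime H p : ℂ) / (p : ℂ) ^ (1 + s)‖
        ≤ ‖(1 : ℂ)‖ + ‖(nuPrime H p : ℂ) / (p : ℂ) ^ (1 + s)‖ := norm_sub_le _ _
      _ = 1 + nuPrime H p * x := by
          rw [norm_one, norm_div, Complex.norm_natCast, ← hzx, Complex.cpow_neg, norm_inv,
            div_eq_mul_inv]
      _ ≤ 1 + #H * x := by gcongr; exact_mod_cast nuPrime_le_card H p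
      _ ≤ Real.exp (#H * x) := by linarith [Real.add_one_le_exp ((#H : ℝ) * x)]
  -- second factor
  have h2 : ‖((1 - (p : ℂ) ^ (-(1 + s)))⁻¹) ^ #H‖ ≤ Real.exp (3 * #H * x) := by
    rw [norm_pow, norm_inv]
    have hlow : 1 - x ≤ ‖1 - (p : ℂ) ^ (-(1 + s))‖ := by
      have := norm_sub_norm_le (1 : ℂ) ((p : ℂ) ^ (-(1 + s)))
      rwa [norm_one, hzx] at this
    have h1x : 0 < 1 - x := by linarith
    have hinv : ‖1 - (p : ℂ) ^ (-(1 + s))‖⁻¹ ≤ 1 + 3 * x := by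
      refine (inv_anti₀ h1x hlow).trans ?_
      rw [inv_eq_one_div, div_le_iff₀ h1x]
      nlinarith
    calc ‖1 - (p : ℂ) ^ (-(1 + s))‖⁻¹ ^ #H ≤ (1 + 3 * x) ^ #H :=
          pow_le_pow_left₀ (by positivity) hinv _
      _ ≤ Real.exp (3 * x) ^ #H :=
          pow_le_pow_left₀ (by positivity) (by linarith [Real.add_one_le_exp (3 * x)]) _
      _ = Real.exp (3 * #H * x) := by rw [← Real.exp_nat_mul]; ring_nf
  calc ‖GFactor H p s‖ = ‖FFactor H p s‖ * ‖((1 - (p : ℂ) ^ (-(1 + s)))⁻¹) ^ #H‖ := norm_mul _ _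
    _ ≤ Real.exp (#H * x) * Real.exp (3 * #H * x) :=
        mul_le_mul h1 h2 (norm_nonneg _) (by positivity)
    _ = Real.exp (4 * #H * x) := by rw [← Real.exp_add]; ring_nf

/-- For `p > U`, `p ∤ Δ` and `σ ≥ −1/4`: `ν_p = k`, `k p^{−1−σ} ≤ 1/2`, and the factor of `G_H` is
`exp(gLog)` with `|gLog| ≤ 2k² p^{−2−2σ}`, so `|factor| ≤ exp(2k² p^{−2−2σ})`.
[cite: GoldstonPintzYildirim2009, Section 6 eq. 6.16] -/
theorem norm_GFactor_le_exp_sq {H : Finset ℕ} (hH : H.Nonempty) {h p : ℕ} (hp : p.Prime)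
    (hpU : gpyU #H h < p) (hΔ : ¬ p ∣ discr H) {s : ℂ} (hs : -1 / 4 ≤ s.re) :
    ‖GFactor H p s‖ ≤ Real.exp (2 * (#H : ℝ) ^ 2 * ((p : ℝ) ^ (-(1 + s.re))) ^ 2) := by
  have hk := card_mul_rpow_le_half (k := #H) hpU hs
  have hk' : (#H : ℝ) * ‖(p : ℂ) ^ (-(1 + s))‖ ≤ 1 / 2 := by rwa [norm_natCast_cpow_neg hp.pos]
  have hG : GFactor H p s = Complex.exp (gLog #H p s) := by
    rw [exp_gLog hk' hH.card_pos, GFactor, FFactor, nuPrime_eq_card_of_not_dvd hΔ,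
      div_eq_mul_inv, ← Complex.cpow_neg]
  rw [hG]
  refine (Complex.norm_exp_le_exp_norm _).trans ?_
  rw [Real.exp_le_exp, ← norm_natCast_cpow_neg hp.pos]
  exact norm_gLog_le hk' hH.card_pos


/-! ### The three prime sums of the proof of (6.16) -/

/-- `∑_{N < n ≤ M} n^{−a} ≤ N^{1−a}/(a−1)` for `a > 1`, `N ≥ 1` (comparison with
`∫_N^∞ x^{−a} dx`). [folklore] -/
theorem sum_Ioc_rpow_neg_le {N M : ℕ} (hN : 1 ≤ N) {a : ℝ} (ha : 1 < a) :
    ∑ n ∈ Finset.Ioc N M, (n : ℝ) ^ (-a) ≤ (N : ℝ) ^ (1 - a) / (a - 1) := by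
  have hN0 : (0 : ℝ) < N := by exact_mod_cast hN
  rcases le_or_gt M N with hMN | hMN
  · rw [Finset.Ioc_eq_empty (by omega), Finset.sum_empty]
    all_goals positivity
  have hmap : Finset.Ioc N M = (Finset.Ico N M).map (addRightEmbedding 1) := by
    ext n; simp [Finset.mem_Ioc, Finset.mem_Ico]
  rw [hmap, Finset.sum_map]
  have hanti : AntitoneOn (fun x : ℝ => x ^ (-a)) (Set.Icc (N : ℝ) M) := fun x hx y _ hxy =>
    Real.rpow_le_rpow_of_nonpos (hN0.trans_le hx.1) hxy (by linarith)
  have h := AntitoneOn.sum_le_integral_Ico hMN.le hanti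
  simp only [Nat.cast_add, Nat.cast_one] at h
  refine le_trans (by simpa using h) ?_
  have h0 : (0 : ℝ) ∉ Set.uIcc (N : ℝ) M := fun h0 => by
    rcases Set.mem_uIcc.1 h0 with ⟨h1, _⟩ | ⟨h1, _⟩
    · linarith
    · have : (N : ℝ) < M := by exact_mod_cast hMN
      linarith
  rw [integral_rpow (Or.inr ⟨by linarith, h0⟩)]
  have hM0 : (0 : ℝ) ≤ (M : ℝ) ^ (-a + 1) := by positivity
  have key : ((M : ℝ) ^ (-a + 1) - (N : ℝ) ^ (-a + 1)) / (-a + 1) =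
      ((N : ℝ) ^ (-a + 1) - (M : ℝ) ^ (-a + 1)) / (a - 1) := by
    rw [show -a + 1 = -(a - 1) by ring, div_neg, ← neg_div, neg_sub]
  rw [key, show (N : ℝ) ^ (1 - a) = (N : ℝ) ^ (-a + 1) by ring_nf]
  exact div_le_div_of_nonneg_right (sub_le_self _ hM0) (by linarith)

/-- `k U^{δ−1} ≤ 1/2` for `δ ≤ 1/4` (from `2k ≤ √U`, `U ≥ 16`).
[cite: GoldstonPintzYildirim2009, Section 6 eq. 6.16] -/
theorem card_mul_gpyU_rpow_le_half (k h : ℕ) {δ : ℝ} (hδ : δ ≤ 1 / 4) :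
    (k : ℝ) * gpyU k h ^ (δ - 1) ≤ 1 / 2 := by
  have hU := gpyU_pos k h
  have hU1 : (1 : ℝ) ≤ gpyU k h := by linarith [sixteen_le_gpyU k h]
  have h3 : gpyU k h ^ (δ - 1) ≤ gpyU k h ^ (-(1 / 2 : ℝ)) :=
    Real.rpow_le_rpow_of_exponent_le hU1 (by linarith)
  have h4 : gpyU k h ^ (-(1 / 2 : ℝ)) = (Real.sqrt (gpyU k h))⁻¹ := by
    rw [Real.rpow_neg hU.le, Real.sqrt_eq_rpow]
  have hsqrt : 0 < Real.sqrt (gpyU k h) := Real.sqrt_pos.2 hU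
  have hk := two_mul_card_le_sqrt_gpyU k h
  calc (k : ℝ) * gpyU k h ^ (δ - 1) ≤ (Real.sqrt (gpyU k h) / 2) * (Real.sqrt (gpyU k h))⁻¹ := by
        rw [← h4]
        exact mul_le_mul (by linarith) h3 (by positivity) (by positivity)
    _ = 1 / 2 := by field_simp

/-- Sum over the primes `p ≤ U`:
`∑_{p ≤ U} 4k p^{−1−σ} ≤ 4k U^δ ∑_{p ≤ U} 1/p ≤ 4kU^δ(log log U + 4)`
(Mertens, the tree's `Literature.sum_inv_prime_le`).
[cite: GoldstonPintzYildirim2009, Section 6 eq. 6.16] -/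
theorem sum_small_le (k h : ℕ) (σ : ℝ) (S : Finset Nat.Primes) :
    ∑ p ∈ S.filter (fun p : Nat.Primes => ((p : ℕ) : ℝ) ≤ gpyU k h),
        4 * (k : ℝ) * (p : ℝ) ^ (-(1 + σ)) ≤
      4 * k * gpyU k h ^ (max (-σ) 0) * (Real.log (Real.log (gpyU k h)) + 4) := by
  set U := gpyU k h with hUdef
  set δ := max (-σ) 0 with hδdef
  have hU := gpyU_pos k h
  have hU16 := sixteen_le_gpyU k h
  have hδ0 : 0 ≤ δ := le_max_right _ _
  set S₁ := S.filter (fun p : Nat.Primes => ((p : ℕ) : ℝ) ≤ U) with hS₁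
  -- termwise `p^{-(1+σ)} ≤ U^δ / p`
  have hterm : ∀ p ∈ S₁, 4 * (k : ℝ) * (p : ℝ) ^ (-(1 + σ)) ≤ 4 * k * U ^ δ * (1 / (p : ℝ)) := by
    intro p hp
    have hpU : (p : ℝ) ≤ U := (Finset.mem_filter.1 hp).2
    have hp1 : (1 : ℝ) ≤ p := by exact_mod_cast p.2.one_lt.le
    have hp0 : (0 : ℝ) < p := by linarith
    have e1 : (p : ℝ) ^ (-(1 + σ)) ≤ (p : ℝ) ^ (δ - 1) :=
      Real.rpow_le_rpow_of_exponent_le hp1 (by linarith [le_max_left (-σ) 0])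
    have e2 : (p : ℝ) ^ (δ - 1) = (p : ℝ) ^ δ * (1 / p) := by
      rw [Real.rpow_sub hp0, Real.rpow_one, mul_one_div]
    have e3 : (p : ℝ) ^ δ ≤ U ^ δ := Real.rpow_le_rpow hp0.le hpU hδ0
    rw [mul_assoc (4 * (k : ℝ))]
    refine mul_le_mul_of_nonneg_left (e1.trans ?_) (by positivity)
    rw [e2]
    exact mul_le_mul_of_nonneg_right e3 (by positivity)
  refine (Finset.sum_le_sum hterm).trans ?_
  rw [← Finset.mul_sum]
  refine mul_le_mul_of_nonneg_left ?_ (by positivity)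
  -- `∑_{p ∈ S₁} 1/p ≤ ∑_{p ≤ ⌊U⌋} 1/p ≤ log log U + 4`
  have hmap : ∑ p ∈ S₁, (1 / (p : ℝ)) =
      ∑ q ∈ S₁.map ⟨Subtype.val, Nat.Primes.coe_nat_injective⟩, (1 / (q : ℝ)) := by
    rw [Finset.sum_map]; rfl
  have hsub : S₁.map ⟨Subtype.val, Nat.Primes.coe_nat_injective⟩ ⊆ Nat.primesLE ⌊U⌋₊ := by
    intro q hq
    obtain ⟨p, hp, rfl⟩ := Finset.mem_map.1 hq
    have hpU : (p : ℝ) ≤ U := (Finset.mem_filter.1 hp).2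
    exact Nat.mem_primesLE.2 ⟨Nat.le_floor hpU, p.2⟩
  have hfloor2 : 2 ≤ ⌊U⌋₊ := Nat.le_floor (by norm_num; linarith)
  have hfloorU : (⌊U⌋₊ : ℝ) ≤ U := Nat.floor_le hU.le
  have hfloor16 : (16 : ℝ) ≤ ⌊U⌋₊ := by
    have := Nat.le_floor (α := ℝ) (a := U) (n := 16) (by norm_num; linarith)
    exact_mod_cast this
  rw [hmap]
  calc ∑ q ∈ S₁.map ⟨Subtype.val, Nat.Primes.coe_nat_injective⟩, (1 / (q : ℝ))
      ≤ ∑ q ∈ Nat.primesLE ⌊U⌋₊, (1 / (q : ℝ)) :=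
        Finset.sum_le_sum_of_subset_of_nonneg hsub fun q _ _ => by positivity
    _ ≤ Real.log (Real.log ⌊U⌋₊) + 4 := Literature.NumberTheory.LFunctions.MertensBound.sum_inv_prime_le ⌊U⌋₊ hfloor2
    _ ≤ Real.log (Real.log U) + 4 := by
        have h1 : 1 < Real.log ⌊U⌋₊ := by
          rw [Real.lt_log_iff_exp_lt (by linarith)]
          linarith [Real.exp_one_lt_d9]
        linarith [Real.log_le_log (by linarith) (Real.log_le_log (by linarith) hfloorU)]

/-- Sum over the primes `p > U` dividing `Δ`: at most `log₂ Δ ≤ U/log 2` of them, each contributing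
`≤ 4k U^{δ−1}`: `∑ ≤ (4/log 2) k U^δ ≤ 6kU^δ`. (GPY bound this piece by `exp(4kU^δ)` using
`∑_{U<n≤2U} 1/n`.) [cite: GoldstonPintzYildirim2009, Section 6 eq. 6.16] -/
theorem sum_dvd_le {H : Finset ℕ} {h : ℕ} (hh : ∀ x ∈ H, x ≤ h) {σ : ℝ} (hσ : -1 / 4 ≤ σ)
    (S : Finset Nat.Primes) :
    ∑ p ∈ S.filter (fun p : Nat.Primes => gpyU #H h < ((p : ℕ) : ℝ) ∧ (p : ℕ) ∣ discr H),
        4 * (#H : ℝ) * (p : ℝ) ^ (-(1 + σ)) ≤ 6 * #H * gpyU #H h ^ (max (-σ) 0) := by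
  set k := #H with hk
  set U := gpyU k h with hUdef
  set δ := max (-σ) 0 with hδdef
  have hU := gpyU_pos k h
  have hδ0 : 0 ≤ δ := le_max_right _ _
  have hδ4 : δ ≤ 1 / 4 := max_le (by linarith) (by norm_num)
  set S₂ := S.filter (fun p : Nat.Primes => U < ((p : ℕ) : ℝ) ∧ (p : ℕ) ∣ discr H) with hS₂
  have hterm : ∀ p ∈ S₂, 4 * (k : ℝ) * (p : ℝ) ^ (-(1 + σ)) ≤ 4 * k * U ^ (δ - 1) := by
    intro p hp
    have hpU : U < (p : ℝ) := (Finset.mem_filter.1 hp).2.1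
    have hp1 : (1 : ℝ) ≤ p := by exact_mod_cast p.2.one_lt.le
    refine mul_le_mul_of_nonneg_left ?_ (by positivity)
    calc (p : ℝ) ^ (-(1 + σ)) ≤ (p : ℝ) ^ (δ - 1) :=
          Real.rpow_le_rpow_of_exponent_le hp1 (by linarith [le_max_left (-σ) 0])
      _ ≤ U ^ (δ - 1) := Real.rpow_le_rpow_of_nonpos hU hpU.le (by linarith)
  refine (Finset.sum_le_sum hterm).trans ?_
  rw [Finset.sum_const, nsmul_eq_mul]
  -- `#S₂ ≤ #(primeFactors Δ) ≤ log Δ / log 2 ≤ U / log 2`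
  have hcard : (S₂.card : ℝ) ≤ U / Real.log 2 := by
    have hΔ0 : discr H ≠ 0 := (discr_pos H).ne'
    have hsub : S₂.map ⟨Subtype.val, Nat.Primes.coe_nat_injective⟩ ⊆ (discr H).primeFactors := by
      intro q hq
      obtain ⟨p, hp, rfl⟩ := Finset.mem_map.1 hq
      exact Nat.mem_primeFactors.2 ⟨p.2, (Finset.mem_filter.1 hp).2.2, hΔ0⟩
    have h1 : S₂.card ≤ (discr H).primeFactors.card :=
      calc S₂.card = (S₂.map ⟨Subtype.val, Nat.Primes.coe_nat_injective⟩).card :=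
            (Finset.card_map _).symm
        _ ≤ (discr H).primeFactors.card := Finset.card_le_card hsub
    have h2 : ((discr H).primeFactors.card : ℝ) * Real.log 2 ≤ Real.log (discr H) := by
      rw [← Real.log_pow]
      exact Real.log_le_log (by positivity) (by exact_mod_cast two_pow_card_primeFactors_le hΔ0)
    have hlog2 : 0 < Real.log 2 := Real.log_pos one_lt_two
    rw [le_div_iff₀ hlog2]
    calc (S₂.card : ℝ) * Real.log 2 ≤ (discr H).primeFactors.card * Real.log 2 := by
          gcongr
      _ ≤ Real.log (discr H) := h2
      _ ≤ U := log_discr_le_gpyU hh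
  have hlog2 : Real.log 2 > 0.6931471803 := Real.log_two_gt_d9
  have hUδ : U ^ (δ - 1) * U = U ^ δ := by
    rw [Real.rpow_sub_one hU.ne', div_mul_cancel₀ _ hU.ne']
  calc (S₂.card : ℝ) * (4 * k * U ^ (δ - 1)) ≤ U / Real.log 2 * (4 * k * U ^ (δ - 1)) :=
        mul_le_mul_of_nonneg_right hcard (by positivity)
    _ = (4 / Real.log 2) * k * (U ^ (δ - 1) * U) := by ring
    _ = (4 / Real.log 2) * k * U ^ δ := by rw [hUδ]
    _ ≤ 6 * k * U ^ δ := by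
        have : 4 / Real.log 2 ≤ 6 := by rw [div_le_iff₀ (by linarith)]; linarith
        gcongr

/-- Sum over all primes `p > U`: `∑_{p>U} 2k² p^{−2−2σ} ≤ 2k² ∑_{n>U} n^{−(2−2δ)} ≤ 4k² ⌊U⌋^{2δ−1}
≤ (64/15) k² U^{2δ−1} ≤ 3kU^δ` (using `kU^{δ−1} ≤ 1/2`).
[cite: GoldstonPintzYildirim2009, Section 6 eq. 6.16] -/
theorem sum_large_le (k h : ℕ) {σ : ℝ} (hσ : -1 / 4 ≤ σ) (S : Finset Nat.Primes) :
    ∑ p ∈ S.filter (fun p : Nat.Primes => gpyU k h < ((p : ℕ) : ℝ)),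
        2 * (k : ℝ) ^ 2 * ((p : ℝ) ^ (-(1 + σ))) ^ 2 ≤ 3 * k * gpyU k h ^ (max (-σ) 0) := by
  set U := gpyU k h with hUdef
  set δ := max (-σ) 0 with hδdef
  have hU := gpyU_pos k h
  have hU16 := sixteen_le_gpyU k h
  have hδ0 : 0 ≤ δ := le_max_right _ _
  have hδ4 : δ ≤ 1 / 4 := max_le (by linarith) (by norm_num)
  set a : ℝ := 2 - 2 * δ with hadef
  have ha : 3 / 2 ≤ a := by linarith
  set N := ⌊U⌋₊ with hNdef
  have hNU : (N : ℝ) ≤ U := Nat.floor_le hU.le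
  have hUN : U - 1 < N := by have := Nat.lt_floor_add_one U; linarith
  have hN1 : 1 ≤ N := Nat.le_floor (by norm_num; linarith)
  have hN0 : (0 : ℝ) < N := by exact_mod_cast hN1
  set S₃ := S.filter (fun p : Nat.Primes => U < ((p : ℕ) : ℝ)) with hS₃
  -- termwise `(p^{-(1+σ)})² ≤ p^{-a}`
  have hterm : ∀ p ∈ S₃, 2 * (k : ℝ) ^ 2 * ((p : ℝ) ^ (-(1 + σ))) ^ 2 ≤
      2 * (k : ℝ) ^ 2 * (p : ℝ) ^ (-a) := by
    intro p hp
    have hp1 : (1 : ℝ) ≤ p := by exact_mod_cast p.2.one_lt.le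
    refine mul_le_mul_of_nonneg_left ?_ (by positivity)
    rw [← Real.rpow_natCast ((p : ℝ) ^ (-(1 + σ))) 2, ← Real.rpow_mul (by positivity)]
    exact Real.rpow_le_rpow_of_exponent_le hp1 (by push_cast; linarith [le_max_left (-σ) 0])
  refine (Finset.sum_le_sum hterm).trans ?_
  rw [← Finset.mul_sum]
  -- `∑_{p ∈ S₃} p^{-a} ≤ ∑_{N < n ≤ M} n^{-a} ≤ N^{1-a}/(a-1)`
  set M := (S₃.map ⟨Subtype.val, Nat.Primes.coe_nat_injective⟩).sup id with hMdef
  have hsub : S₃.map ⟨Subtype.val, Nat.Primes.coe_nat_injective⟩ ⊆ Finset.Ioc N M := by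
    intro q hq
    have hqM : q ≤ M := Finset.le_sup (f := id) hq
    obtain ⟨p, hp, rfl⟩ := Finset.mem_map.1 hq
    have hpU : U < (p : ℝ) := (Finset.mem_filter.1 hp).2
    refine Finset.mem_Ioc.2 ⟨?_, hqM⟩
    have : (N : ℝ) < (p : ℕ) := lt_of_le_of_lt hNU hpU
    exact_mod_cast this
  have hsum : ∑ p ∈ S₃, (p : ℝ) ^ (-a) ≤ (N : ℝ) ^ (1 - a) / (a - 1) := by
    have hmap : ∑ p ∈ S₃, (p : ℝ) ^ (-a) =
        ∑ q ∈ S₃.map ⟨Subtype.val, Nat.Primes.coe_nat_injective⟩, (q : ℝ) ^ (-a) := by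
      rw [Finset.sum_map]; rfl
    rw [hmap]
    exact (Finset.sum_le_sum_of_subset_of_nonneg hsub fun q _ _ => by positivity).trans
      (sum_Ioc_rpow_neg_le hN1 (by linarith))
  -- `N^{1-a} ≤ (16/15) U^{1-a}` and `1/(a-1) ≤ 2`
  have hN1516 : (15 / 16) * U ≤ N := by linarith
  have hNpow : (N : ℝ) ^ (1 - a) ≤ (16 / 15) * U ^ (1 - a) := by
    calc (N : ℝ) ^ (1 - a) ≤ ((15 / 16) * U) ^ (1 - a) :=
          Real.rpow_le_rpow_of_nonpos (by positivity) hN1516 (by linarith)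
      _ = (15 / 16 : ℝ) ^ (1 - a) * U ^ (1 - a) := Real.mul_rpow (by norm_num) hU.le
      _ ≤ (16 / 15) * U ^ (1 - a) := by
          refine mul_le_mul_of_nonneg_right ?_ (by positivity)
          calc (15 / 16 : ℝ) ^ (1 - a) ≤ (15 / 16 : ℝ) ^ (-1 : ℝ) :=
                Real.rpow_le_rpow_of_exponent_ge (by norm_num) (by norm_num) (by linarith)
            _ = 16 / 15 := by rw [Real.rpow_neg_one]; norm_num
  have hUa : U ^ (1 - a) = U ^ (δ - 1) * U ^ δ := by
    rw [← Real.rpow_add hU]; congr 1; rw [hadef]; ring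
  have hkU : (k : ℝ) * U ^ (δ - 1) ≤ 1 / 2 := card_mul_gpyU_rpow_le_half k h hδ4
  calc 2 * (k : ℝ) ^ 2 * ∑ p ∈ S₃, (p : ℝ) ^ (-a)
      ≤ 2 * (k : ℝ) ^ 2 * ((N : ℝ) ^ (1 - a) / (a - 1)) :=
        mul_le_mul_of_nonneg_left hsum (by positivity)
    _ ≤ 2 * (k : ℝ) ^ 2 * ((16 / 15) * U ^ (1 - a) / (1 / 2)) := by
        gcongr
        all_goals linarith
    _ = (64 / 15) * k * ((k : ℝ) * U ^ (δ - 1)) * U ^ δ := by rw [hUa]; ring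
    _ ≤ (64 / 15) * k * (1 / 2) * U ^ δ := by gcongr
    _ ≤ 3 * k * U ^ δ := by
        nlinarith [mul_nonneg (Nat.cast_nonneg k : (0 : ℝ) ≤ k) (Real.rpow_nonneg hU.le δ)]


/-! ### Assembly: (6.16) -/

/-- Finite partial products: for every finite set `S` of primes and `σ ≥ −1/4`,
`∏_{p ∈ S} |GFactor_p(s)| ≤ exp(k U^δ (4 log log U + 25))`, `δ = max(−σ, 0)`, `U = gpyU k h`.
[cite: GoldstonPintzYildirim2009, Section 6 eq. 6.16] -/
theorem prod_norm_GFactor_le {H : Finset ℕ} (hH : H.Nonempty) {h : ℕ} (hh : ∀ x ∈ H, x ≤ h)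
    {s : ℂ} (hs : -1 / 4 ≤ s.re) (S : Finset Nat.Primes) :
    ∏ p ∈ S, ‖GFactor H p s‖ ≤ Real.exp (#H * gpyU #H h ^ (max (-s.re) 0) *
      (4 * Real.log (Real.log (gpyU #H h)) + 25)) := by
  set k := #H with hk
  set U := gpyU k h with hUdef
  set σ := s.re with hσdef
  set δ := max (-σ) 0 with hδdef
  have hU := gpyU_pos k h
  -- the three majorants
  set A : Nat.Primes → ℝ := fun p => if ((p : ℕ) : ℝ) ≤ U then
    4 * (k : ℝ) * (p : ℝ) ^ (-(1 + σ)) else 0 with hA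
  set B : Nat.Primes → ℝ := fun p => if U < ((p : ℕ) : ℝ) ∧ (p : ℕ) ∣ discr H then
    4 * (k : ℝ) * (p : ℝ) ^ (-(1 + σ)) else 0 with hB
  set C : Nat.Primes → ℝ := fun p => if U < ((p : ℕ) : ℝ) then
    2 * (k : ℝ) ^ 2 * ((p : ℝ) ^ (-(1 + σ))) ^ 2 else 0 with hC
  have hterm : ∀ p : Nat.Primes, ‖GFactor H p s‖ ≤ Real.exp (A p + B p + C p) := by
    intro p
    by_cases hpU : ((p : ℕ) : ℝ) ≤ U
    · have hA' : A p = 4 * (k : ℝ) * (p : ℝ) ^ (-(1 + σ)) := if_pos hpU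
      have hB' : B p = 0 := if_neg (fun h' => not_lt.2 hpU h'.1)
      have hC' : C p = 0 := if_neg (not_lt.2 hpU)
      rw [hA', hB', hC', add_zero, add_zero]
      exact norm_GFactor_le_exp H p.2 hs
    · rw [not_le] at hpU
      have hA' : A p = 0 := if_neg (not_le.2 hpU)
      have hC' : C p = 2 * (k : ℝ) ^ 2 * ((p : ℝ) ^ (-(1 + σ))) ^ 2 := if_pos hpU
      by_cases hpΔ : (p : ℕ) ∣ discr H
      · have hB' : B p = 4 * (k : ℝ) * (p : ℝ) ^ (-(1 + σ)) := if_pos ⟨hpU, hpΔ⟩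
        rw [hA', hB', hC', zero_add]
        refine (norm_GFactor_le_exp H p.2 hs).trans (Real.exp_le_exp.2 ?_)
        have : 0 ≤ 2 * (k : ℝ) ^ 2 * ((p : ℝ) ^ (-(1 + σ))) ^ 2 := by positivity
        linarith
      · have hB' : B p = 0 := if_neg (fun h' => hpΔ h'.2)
        rw [hA', hB', hC', zero_add, zero_add]
        exact norm_GFactor_le_exp_sq hH p.2 hpU hpΔ hs
  have h1 : ∏ p ∈ S, ‖GFactor H p s‖ ≤ Real.exp (∑ p ∈ S, (A p + B p + C p)) := by
    rw [Real.exp_sum]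
    exact Finset.prod_le_prod (fun p _ => norm_nonneg _) fun p _ => hterm p
  refine h1.trans (Real.exp_le_exp.2 ?_)
  rw [Finset.sum_add_distrib, Finset.sum_add_distrib]
  have hAs : ∑ p ∈ S, A p ≤ 4 * k * U ^ δ * (Real.log (Real.log U) + 4) := by
    rw [hA, ← Finset.sum_filter]; exact sum_small_le k h σ S
  have hBs : ∑ p ∈ S, B p ≤ 6 * k * U ^ δ := by
    rw [hB, ← Finset.sum_filter]; exact sum_dvd_le hh hs S
  have hCs : ∑ p ∈ S, C p ≤ 3 * k * U ^ δ := by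
    rw [hC, ← Finset.sum_filter]; exact sum_large_le k h hs S
  have : 4 * k * U ^ δ * (Real.log (Real.log U) + 4) + 6 * k * U ^ δ + 3 * k * U ^ δ =
      k * U ^ δ * (4 * Real.log (Real.log U) + 25) := by ring
  linarith

/-- **GPY (6.16)**: for `−1/4 ≤ σ` (and all `t`), with `δ = max(−σ, 0)`, `k = |H| ≥ 1`,
`H ⊆ [0, h]`, `U = max(16, 4k², k² log 2h)`:
`|G_H(s)| ≤ exp(k U^δ (4 log log U + 25))` — GPY's `G_H(s) ≪ exp(5kU^δ log log U)` with explicit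
constants (the three pieces: primes `p ≤ U` by Mertens, primes `p ∣ Δ` above `U` by `ω(Δ) ≤ log₂ Δ ≤
U/log 2`, and the tail `p > U`, `p ∤ Δ` by `|g_p| ≤ 2k² p^{−2−2σ}`).
[cite: GoldstonPintzYildirim2009, Section 6 eq. 6.16] -/
theorem norm_GH_le {H : Finset ℕ} (hH : H.Nonempty) {h : ℕ} (hh : ∀ x ∈ H, x ≤ h)
    {s : ℂ} (hs : -1 / 4 ≤ s.re) :
    ‖GH H s‖ ≤ Real.exp (#H * gpyU #H h ^ (max (-s.re) 0) *
      (4 * Real.log (Real.log (gpyU #H h)) + 25)) := by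
  have hprod : HasProd (fun p : Nat.Primes => GFactor H p s) (GH H s) :=
    (multipliable_GFactor hH (by linarith : -1 / 2 < s.re)).hasProd
  have ht : Tendsto (fun S : Finset Nat.Primes => ‖∏ p ∈ S, GFactor H p s‖) atTop
      (𝓝 ‖GH H s‖) := (continuous_norm.tendsto _).comp hprod
  refine le_of_tendsto' ht fun S => ?_
  rw [norm_prod]
  exact prod_norm_GFactor_le hH hh hs S

end Literature.NumberTheory.Sieve.GPY
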